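/-
COR-CM (cells pub-hodgecm / pub-hodgecm2, stage 2 of the Hodge ladder) — junction B01, item (vi) S2 pinning lane, TEAM hCMisogE WAVE 2:
the (β)-FREE MEETING-FORM TWIN of the READING end display `Model.hc_cm_of_thm418AsPrinted_pinnedE_def45Reading`
(`Transposition/Item6SupplyPinnedDef45Reading.lean`, hcmisog-glue, p308248) — asked for by the red team (TGTBT DELTA 15 row 73: «the
Def45-Reading display has no (β)-free twin») and worded by the owner of record of `hCMisogE` (pin-2 g2, HOME/INBOX l.6669 (B) «glue: file
Def45ReadingMeeting — YES»), on own-htheta's pattern `Transposition/Item6SupplyPinnedDef45Meeting.lean` (p309890) and b01-x2's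
`CorCM/B01/FaceWedgeOverlapBypassMeetingPinned.lean` (p301318).  Seat prover-pub-hodgecm2-hcmisog-glue-g5-0 (hcmisog-glue gen 5; rule-(1)
blanket `Transposition/Item6*`, single writer = glue).  Binder texts produced MECHANICALLY from the tree bytes (p308248 :121–156 = the
fourteen binders `D … hComp` of the Reading display; p301318 :113–142 = the `hM` block at `U_rec`), not retyped.  Theorems only (ONE
one-line composition BY NAME): no `def`, no instance, no named fact, nothing asserted, no `sorry`; no other lane's file is modified.
T5 (COORDINATOR RULING 2026-08-21T15:33:56Z (3)): CARRY class — the binder family is p308248's T5-checked family (T5-LEDGER l.58–59)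
− {`hD`} ∪ {`hM`} (p301318's T5-checked `hM`, = p309890's); the line on these exact bytes is quoted in the filing note.
FRAMING: HC_CM is NOT proved; nothing below is an «S2 SUPPLY CLOSED» statement; every displayed hypothesis is OPEN and inhabited by no one.
-/
import Summits.HodgeConjecture.CorCM.B01.Transposition.Item6SupplyPinnedDef45Reading
import Summits.HodgeConjecture.CorCM.B01.FaceWedgeOverlapBypassMeeting
import HarnessLib

/-!
# The Def. 4.5 (2) READING end display without `hD`: Reading pin binders (`C`, `hAμ`) + `hM` ⇒ `HC_CM`

TEAM hCMisogE's READING END DISPLAY `hc_cm_of_thm418AsPrinted_pinnedE_def45Reading (U) (hU) … (C) (hAμ) (hComp) (hD)` (p308248 :118)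
composes its supply junction `faceSupply_of_thm418AsPrinted_pinnedE_def45Reading … : U.FaceSupply` (p308248 :67; the pinning lane's
binders with `hCMisogE` REPLACED by the ⟨CARRIER⟩ components `C : Def45.Carriers` of [Liu 2021] Def. 4.5 (2) and ONE reading binder
`hAμ` «every object `D_μ` of the consumer's `𝒜(μ)`-carrier is a CM datum `X : Def45.CMDatum …` (as-printed typing, `FJcycle.tex`
l. 1944–1958) with `X.A = Aμ₀ F ι₁ V Φ D_μ`», the base-change law and the Hodge comparison being the tree theorems
`AbelianVariety.det_cotangentMap_baseChange` / `cotangent_hodge10_comparison_holds` used by name inside `Model.hCMisogE_of_def45Reading`)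
with `hc_cm_of_supply_of_dictionary_of_eq _ rfl … hD`, whose `hD` carries clause (β) `emb Γ' (cover^* x) = emb Γ x` VERBATIM — ruled
STRONGER-THAN-CONSUMED (tgtbt-1 D5.1) and FALSE at the tree's only model embedding `Model.embOf`.  THIS FILE composes the SAME junction
BY NAME with the (β)-free meeting-form display of the x2 lane `hc_cm_of_supply_of_settingMeetSat_embOf`
(`CorCM/B01/FaceWedgeOverlapBypassMeeting.lean`, p295997), exactly as `Item6SupplyPinnedDef45Meeting.lean` (p309890) does for the two
data-form Def45 junctions and `FaceWedgeOverlapBypassMeetingPinned.lean` (p301318) for the `hCMisogE`-form junction: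
* `hc_cm_of_thm418AsPrinted_pinnedE_def45Reading_settingMeetSat_rec` — p308248's binders {`D`, `Aμ₀`, `AK`, `homE`, `hE`, `hLiu`,
  `hObj`, `hChi`, `hirr`, `hsm`, `hμ`, `C`, `hAμ`, `hComp`} VERBATIM (its order) + `hM` (p301318 :71 binder VERBATIM: ONE isolation
  setting per context over `Lp ℂ 2 V.autMeasure`, C5′ at saturated (12)-sets, C6′, at `U_rec` through `embOf`) ⇒ `HC_CM`.
RESIDUAL BINDERS = EXACTLY that list; no `HG/emb/cover`, no (α)(β)(γ), no `levelMeet`, no `TranslateClosed`.  Their classification is the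
teams' and the red team's (TGTBT D15 rows 73/78; AUDIT-CITESCOPE; HM-EQUALITY): the CM side is Liu's printed Def. 4.5 (2) typing of
`A_μ` read at `ι₁` (existence form `hAμ`, inhabited at a general face only by [Liu 2021] Prop. 4.6 (1), l. 1966–1969 — not in the
tree); `hComp` = TEAM hComp's {hUnif, hAlb}; `hM` = B01-O.  HC_CM is NOT proved: none of these hypotheses is inhabited; count-neutral,
no row change.

References: Y. Liu, *Fourier–Jacobi cycles and arithmetic relative trace formula*, Camb. J. Math. 9 (2021) = arXiv:2102.11518, Def. 4.5
(`FJcycle.tex` l. 1936–1964), Prop. 4.6 (1) l. 1966–1969, Thm. 4.18 l. 2232–2245.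
-/

noncomputable section

set_option autoImplicit false

open scoped TensorProduct InnerProductSpace

namespace Summit.HodgeConjecture.CorCM.Model

open CategoryTheory CategoryTheory.Limits AlgebraicGeometry NumberField MeasureTheory
open Literature.AlgebraicGeometry.Motives
open Literature.AlgebraicGeometry.ShimuraVarieties
open Literature.AlgebraicGeometry.Motives.HodgeStructure (conj)
open Literature.AlgebraicGeometry.HodgeTheory
open Literature.AlgebraicGeometry.ComplexMultiplication (IsCMTypeRealisation)
open Literature.NumberTheory.ComplexMultiplication
open Literature.NumberTheory.Automorphic
open Literature.NumberTheory.Automorphic.IdeleClassGroup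
open Literature.NumberTheory.Automorphic.PicardCM
open Literature.NumberTheory.Automorphic.Liu2021
open Prior.Perl34File (Perl34.IsolationSetting)
open Prior.Perl34File.Perl34

/-! ## §1  Def45-Reading pin binders (p308248's fourteen) + `hM` -/

/-- **Def. 4.5 (2) READING PINNED END DISPLAY, (β)-FREE, SATURATED MEETING FORM, on the universe OF RECORD**
(`exists_isReal_hodgeModel_holds`, `hodgePQ_independent_of_hodgeModel_holds`, `BallQuotient.ballQuotientUniformised_holds`,
`cmAbelianVarietyRealised_holds`, `deligneMilne1982_Thm_6_20_full_holds` plugged in): TEAM hCMisogE's READING supply junction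
`faceSupply_of_thm418AsPrinted_pinnedE_def45Reading` (p308248; its fourteen binders VERBATIM, in its order — the pinning lane's binders
with `hCMisogE` replaced by the [Liu 2021] Def. 4.5 (2) carrier `C : Def45.Carriers` and the ONE reading binder `hAμ` «each object of the
consumer's `𝒜(μ)`-carrier is a CM datum in the as-printed typing `Def45.CMDatum` whose `A_μ` is the pin») composed BY NAME with
`hc_cm_of_supply_of_settingMeetSat_embOf` (`FaceWedgeOverlapBypassMeeting.lean`; binder `hM` VERBATIM at `U_rec`).  Displayed hypotheses
= EXACTLY the fourteen + `hM`; compare `hc_cm_of_thm418AsPrinted_pinnedE_def45Reading _ rfl … hD` (p308248 :118): no `HG/emb/cover`, no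
(α)(β)(γ).  HC_CM is NOT proved: none is inhabited (`hAμ` only by [Liu 2021] Prop. 4.6 (1) at a general face, not in the tree).
[cite: Liu2021, Def. 4.5 (2) (FJcycle.tex l. 1944–1958), Prop. 4.6 (1) (l. 1966–1969), Thm. 4.18 (l. 2232–2245)] -/
theorem hc_cm_of_thm418AsPrinted_pinnedE_def45Reading_settingMeetSat_rec
    (D : ∀ (F : CMField) (ι₁ : F →+* ℂ) (_ : HermSpace3 F ι₁) (_ : CMType F), Thm418Data (maximalRealSubfield F) F)
    (Aμ₀ : ∀ (F : CMField) (ι₁ : F →+* ℂ) (V : HermSpace3 F ι₁) (Φ : CMType F), (D F ι₁ V Φ).Obj → AbelianVariety F)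
    (AK : ∀ (F : CMField) (ι₁ : F →+* ℂ) (V : HermSpace3 F ι₁) (Φ : CMType F), Subgroup (D F ι₁ V Φ).G → AbelianVariety F)
    (homE : ∀ (F : CMField) (ι₁ : F →+* ℂ) (V : HermSpace3 F ι₁) (Φ : CMType F) (K : Subgroup (D F ι₁ V Φ).G)
      (Dμ : (D F ι₁ V Φ).Obj), (D F ι₁ V Φ).HomK K Dμ →+ ℚ ⊗[ℤ] (AK F ι₁ V Φ K ⟶ Aμ₀ F ι₁ V Φ Dμ))
    (hE : ∀ (F : CMField) (ι₁ : F →+* ℂ) (V : HermSpace3 F ι₁) (Φ : CMType F) (K : Subgroup (D F ι₁ V Φ).G)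
      (Dμ : (D F ι₁ V Φ).Obj), Function.Injective (homE F ι₁ V Φ K Dμ))
    (hLiu : ∀ (F : CMField), IsGalois ℚ F → 6 ≤ Module.finrank ℚ F → ∀ (Φ : CMType F) (ι₁ : F →+* ℂ), ι₁ ∈ Φ.1 →
      ∀ V : HermSpace3 F ι₁, Thm418AsPrinted (D F ι₁ V Φ))
    (hObj : ∀ (F : CMField), IsGalois ℚ F → 6 ≤ Module.finrank ℚ F → ∀ (Φ : CMType F) (ι₁ : F →+* ℂ), ι₁ ∈ Φ.1 →
      ∀ V : HermSpace3 F ι₁, Nonempty (D F ι₁ V Φ).Obj)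
    (hChi : ∀ (F : CMField), IsGalois ℚ F → 6 ≤ Module.finrank ℚ F → ∀ (Φ : CMType F) (ι₁ : F →+* ℂ), ι₁ ∈ Φ.1 →
      ∀ V : HermSpace3 F ι₁, Nonempty (D F ι₁ V Φ).Chi)
    (hirr : ∀ (F : CMField), IsGalois ℚ F → 6 ≤ Module.finrank ℚ F → ∀ (Φ : CMType F) (ι₁ : F →+* ℂ), ι₁ ∈ Φ.1 →
      ∀ (V : HermSpace3 F ι₁) (i : (D F ι₁ V Φ).AdmIndex), ((D F ι₁ V Φ).rhoAt i).IsIrreducible)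
    (hsm : ∀ (F : CMField), IsGalois ℚ F → 6 ≤ Module.finrank ℚ F → ∀ (Φ : CMType F) (ι₁ : F →+* ℂ), ι₁ ∈ Φ.1 →
      ∀ (V : HermSpace3 F ι₁) (i : (D F ι₁ V Φ).AdmIndex) (v : (D F ι₁ V Φ).omegaAt i),
        ∃ S : Subgroup (D F ι₁ V Φ).G, IsOpen (S : Set (D F ι₁ V Φ).G) ∧ ∀ k ∈ S, (D F ι₁ V Φ).rhoAt i k v = v)
    (hμ : ∀ (F : CMField), IsGalois ℚ F → 6 ≤ Module.finrank ℚ F → ∀ (Φ : CMType F) (ι₁ : F →+* ℂ), ι₁ ∈ Φ.1 →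
      ∀ (V : HermSpace3 F ι₁) (g : F ≃ₐ[ℚ] F),
        ι₁.comp (g : F →+* F) ∈ (D F ι₁ V Φ).cmType.1 ↔ ι₁.comp (g.symm : F →+* F) ∈ Φ.1)
    (C : ∀ (F : CMField) (ι₁ : F →+* ℂ) (V : HermSpace3 F ι₁) (Φ : CMType F), Def45.Carriers F (D F ι₁ V Φ).μ)
    (hAμ : ∀ (F : CMField) [IsGalois ℚ F], 6 ≤ Module.finrank ℚ F → ∀ (Φ : CMType F) (ι₁ : F →+* ℂ), ι₁ ∈ Φ.1 →
      ∀ (V : HermSpace3 F ι₁) (Dμ : (D F ι₁ V Φ).Obj),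
        ∃ X : Def45.CMDatum (AlgHom.id ℚ F) ι₁ (D F ι₁ V Φ).isConjugateSymplectic (D F ι₁ V Φ).hasWeight_one
          (C F ι₁ V Φ), X.A = Aμ₀ F ι₁ V Φ Dμ)
    (hComp : ∀ (F : CMField), IsGalois ℚ F → 6 ≤ Module.finrank ℚ F → ∀ (Φ : CMType F) (ι₁ : F →+* ℂ), ι₁ ∈ Φ.1 →
      ∀ V : HermSpace3 F ι₁, ∃ Ksm : Subgroup (D F ι₁ V Φ).G, IsOpenCompact Ksm ∧
        ∀ K : Subgroup (D F ι₁ V Φ).G, IsOpenCompact K → K ≤ Ksm →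
          ∃ (C : Type) (_ : Fintype C) (X : C → SchemeOver ℂ) (B : ∀ c, UnitaryBallUniformisationDatum 2 (X c))
            (Γ : C → Level V) (𝒥 : ∀ c, Jacobian (X c))
            (π : ∀ c, (letI := ι₁.toAlgebra; (AK F ι₁ V Φ K).baseChange ℂ) ⟶ (𝒥 c).J),
            (∀ c, (B c).Hℂ = V.Hm.map ι₁) ∧
            (∀ c, (B c).Γ.map (Matrix.GeneralLinearGroup.map (B c).τ₁) =
              (Γ c).Γ.map (Matrix.GeneralLinearGroup.map ι₁)) ∧
            Nonempty (IsLimit (Fan.mk (letI := ι₁.toAlgebra; (AK F ι₁ V Φ K).baseChange ℂ) π))) :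
    let U := picardCMUniverse exists_isReal_hodgeModel_holds hodgePQ_independent_of_hodgeModel_holds
      BallQuotient.ballQuotientUniformised_holds cmAbelianVarietyRealised_holds
    let hU := ballQuotientUniformisedDatum_of BallQuotient.ballQuotientUniformised_holds
    (∀ (F : CMField), IsGalois ℚ F → 6 ≤ Module.finrank ℚ F → ∀ (f : Face F) (ι₁ : F →+* ℂ), f.Admissible ι₁ →
      ∀ V : HermSpace3 F ι₁,
      ∃ (H CG G SK SigIdx SigIdxG : Type) (_ : NormedAddCommGroup H) (_ : InnerProductSpace ℂ H) (_ : CompleteSpace H)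
        (_ : NormedAddCommGroup CG) (_ : NormedSpace ℂ CG) (_ : Group G) (_ : TopologicalSpace G) (_ : TopologicalSpace SK)
        (S : Perl34.IsolationSetting H (Lp ℂ 2 V.autMeasure) CG G SK SigIdx SigIdxG),
        (∀ (Γ : Level V) (ω₁ ω₂ : U.CohC (U.pms F ι₁ V Γ) 1),
          ω₁ ∈ U.Uiso Γ F (f.psi 0) ι₁ → ω₂ ∈ U.Uiso Γ F (f.psi 1) ι₁ →
            embOf exists_isReal_hodgeModel_holds hodgePQ_independent_of_hodgeModel_holds hU cmAbelianVarietyRealised_holds Γ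
                (U.cup2C (U.pms F ι₁ V Γ) 1 ω₁ ω₂) ≠ 0 →
              ∃ u ∈ S.t12.S12,
                ⟪embOf exists_isReal_hodgeModel_holds hodgePQ_independent_of_hodgeModel_holds hU cmAbelianVarietyRealised_holds Γ
                    (U.cup2C (U.pms F ι₁ V Γ) 1 ω₁ ω₂), u⟫_ℂ ≠ 0) ∧
        (∀ χ : S.t34.X, S.t34.allowed χ → ∀ (Φ : SK) (Γ₁ : Level V)
          (ω₁ ω₂ : U.CohC (U.pms F ι₁ V Γ₁) 1),
          ω₁ ∈ U.Uiso Γ₁ F (f.psi 0) ι₁ →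
          ω₂ ∈ U.Uiso Γ₁ F (f.psi 1) ι₁ →
            ⟪embOf exists_isReal_hodgeModel_holds hodgePQ_independent_of_hodgeModel_holds hU cmAbelianVarietyRealised_holds Γ₁
                (U.cup2C (U.pms F ι₁ V Γ₁) 1 ω₁ ω₂),
              S.t34.ϑ χ Φ⟫_ℂ ≠ 0 →
              ∃ (Γ : Level V) (ω : Fin 4 → U.CohC (U.pms F ι₁ V Γ) 1),
                (∀ i, ω i ∈ U.Uiso Γ F (f.psi i) ι₁) ∧
                  ⟪embOf exists_isReal_hodgeModel_holds hodgePQ_independent_of_hodgeModel_holds hU cmAbelianVarietyRealised_holds Γ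
                      (U.cup2C (U.pms F ι₁ V Γ) 1 (ω 2) (ω 3)),
                    embOf exists_isReal_hodgeModel_holds hodgePQ_independent_of_hodgeModel_holds hU cmAbelianVarietyRealised_holds Γ
                      (U.cup2C (U.pms F ι₁ V Γ) 1 (ω 0) (ω 1))⟫_ℂ
                    ≠ 0)) →
    HC_CM :=
  fun hM ↦ hc_cm_of_supply_of_settingMeetSat_embOf exists_isReal_hodgeModel_holds hodgePQ_independent_of_hodgeModel_holds
    BallQuotient.ballQuotientUniformised_holds cmAbelianVarietyRealised_holds deligneMilne1982_Thm_6_20_full_holds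
    (faceSupply_of_thm418AsPrinted_pinnedE_def45Reading _ _ _ _ D Aμ₀ AK homE hE hLiu hObj hChi hirr hsm hμ C hAμ hComp) hM

end Summit.HodgeConjecture.CorCM.Model

end

#print axioms Summit.HodgeConjecture.CorCM.Model.hc_cm_of_thm418AsPrinted_pinnedE_def45Reading_settingMeetSat_rec
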